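import Summits.ResolutionOfSingularities.ResolutionOfSingularities.Theorems.ShallowPort5

/-!
# ShallowPort6 — THE SHALLOW COLUMN PORT `TightDefectClasses.ShallowColumnPort`, hypothesis-free (§10)

`theorem shallowColumnPort_holds : ShallowColumnPort` — Cossart–Piltant's `CossartPiltant2019LocalPermissible` (Thm. 1.5 (i))
kills every rooted polynomial pure forced tower: the forced tower IS their local sequence (stage `0` = `R[x]_{(x,u)}` by
`nonempty_zeroFrame`; steps = point blowups dominated by the Chevalley valuation ring of the chain,
`chain_isQuadraticTransformAlong`; Bennett–Hironaka pins their permissible centres to the closed points,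
`chain_isMaximal_of_isNormallyFlat`; every stage singular, `chain_not_isRegularLocalRing`), so the tree engine
`false_of_singular_pointTower_of_CP` closes.  Also `polyPureTowersTerminateShallow_of_cp` (the host item under the CP fact).

References: CP 2019 Thm. 1.5, Def. 2.3 [CossartPiltant2019]; CJS LNM 2270 Thm. 3.3 [CossartJannsenSaito2020].
AI-written; weaker than expert review.
(decomp-res lens-5 g38, critic ROW 232 (M-Shallow); host route `MaxContactCut`, item stmt-ResolutionOfSingularities-31768 `PolyPureTowersShallow`;
source of truth: the farm-checked monolith `ShallowPortNode.lean`, of which this is land slice 6/6 — slices land sequentially, slice k imports slice k-1.)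
-/

noncomputable section

set_option linter.dupNamespace false

open IsLocalRing IsLocalization
open Literature.RingTheory.HilbertSamuel Literature.AlgebraicGeometry.Resolution
open Summit.ResolutionOfSingularities.ResolutionOfSingularities.Theorems.SigmaMaxModificationsCorridor3.Helpers
open Summit.ResolutionOfSingularities.ResolutionOfSingularities.Theorems.SwitchingDichotomy.SteeredRun

universe u

namespace Summit.ResolutionOfSingularities.ResolutionOfSingularities.Theorems.ShallowPort

/-! ## §10 The port -/

section Port

open CategoryTheory AlgebraicGeometry
open Summit.ResolutionOfSingularities.ResolutionOfSingularities.Theorems.ForcedTowerClasses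
open Summit.ResolutionOfSingularities.ResolutionOfSingularities.Theorems.HugValuationCut
open Summit.ResolutionOfSingularities.ResolutionOfSingularities.Theorems.TightDefectClasses
open Summit.ResolutionOfSingularities.ResolutionOfSingularities.Cruxes.SigmaMaxModifications.IdeasL1C5

/-- **THE SHALLOW COLUMN PORT** `TightDefectClasses.ShallowColumnPort`, hypothesis-free: Cossart–Piltant's local
permissible resolution (Thm. 1.5, case (i)) kills every rooted polynomial pure forced tower `(𝔸⁴_k, (Z^p + F), p)`.
The forced tower IS Cossart–Piltant's local sequence: stage `0` is the local ring `R[x]_{(x,u)}` of their origin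
(`nonempty_zeroFrame`), every stage map is the point blowup of the previous stage dominated by the Chevalley valuation ring
of the chain (`chain_isQuadraticTransformAlong`), Bennett–Hironaka normal flatness pins their permissible centres to the
closed points (`chain_isMaximal_of_isNormallyFlat`), and every stage is singular (`chain_not_isRegularLocalRing`), so their
terminating regular stage cannot exist (`false_of_singular_pointTower_of_CP`).
[cite: CossartPiltant2019, Thm. 1.5, Def. 2.3] [cite: CossartJannsenSaito2020, Thm 3.3] -/
theorem shallowColumnPort_holds : ShallowColumnPort := by
  intro hCP p hp k _ _ _ F T g hB hD hbd hroot
  rw [pow_one] at hD hroot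
  obtain ⟨Z⟩ := nonempty_zeroFrame hp F T g hB hD hroot
  letI := Z.instField
  letI := Z.instReg
  have hq1 : 1 ≤ p := hp.one_lt.le
  have hq2 : 2 ≤ p := hp.two_le
  obtain ⟨O, hO⟩ := exists_valuationSubring_subringDominates_chain
    (fun i => (chain T g hB hq1 hD Z.S₀ i).φ.range) (fun i => isLocalRing_chain_range T g hB hq1 hD Z.S₀ i)
    (fun i => chain_dominates T g hB hq1 hD Z.S₀ i)
  have hT0 : (chain T g hB hq1 hD Z.S₀ 0).φ.range =
      locAtCentre (Algebra.adjoin Z.R ({Z.x} : Set Z.L)).toSubring O :=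
    locAtCentre_eq_of_fractions Z.hBx Z.hfrac O (hO 0)
  have hRO : Z.R ≤ O.toSubring := le_trans Z.hRB (hO 0).1
  have hdomR : ∀ r : Z.R, r ∈ maximalIdeal Z.R → O.valuation (r : Z.L) < 1 := by
    intro r hr
    by_cases hr0 : (r : Z.L) = 0
    · rw [hr0, map_zero]; exact zero_lt_one
    have h1 : O.valuation (r : Z.L) ≤ 1 := (O.valuation_le_one_iff _).mpr (hRO r.2)
    refine lt_of_le_of_ne h1 fun h1' => Z.inv_not_mem r hr hr0 ?_
    have hinvO : (r : Z.L)⁻¹ ∈ O.toSubring := by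
      change _ ∈ O
      rw [← O.valuation_le_one_iff, map_inv₀, h1', inv_one]
    exact (hO 0).2 _ (Z.hRB r.2) hinvO
  exact false_of_singular_pointTower_of_CP hCP p hp Z.R Z.hexc Z.hdim Z.hchar Z.h Z.x Z.hmon Z.hdeg Z.hx Z.hmin
    Z.hgen (Or.inl Z.hcase) O hRO hdomR (fun i => (chain T g hB hq1 hD Z.S₀ i).φ.range) hT0
    (chain_isQuadraticTransformAlong T g hB hq1 hD Z.S₀ O hO)
    (chain_isMaximal_of_isNormallyFlat T g hB hq1 hD Z.S₀) (chain_not_isRegularLocalRing T g hB hq2 hD Z.S₀)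

/-- Row-check (s1): the port constant, verbatim. -/
example : Summit.ResolutionOfSingularities.ResolutionOfSingularities.Theorems.TightDefectClasses.ShallowColumnPort :=
  shallowColumnPort_holds

/-- **The host-route item, conditional only on the registered Cossart–Piltant fact**: `MaxContactCut.PolyPureTowersShallow`
under `CossartPiltant2019LocalPermissible`. [cite: CossartPiltant2019, Thm. 1.5] -/
theorem polyPureTowersTerminateShallow_of_cp (hCP : CossartPiltant2019LocalPermissible.{0}) :
    PolyPureTowersTerminateShallow :=
  shallowColumnPort_holds hCP

end Port

end Summit.ResolutionOfSingularities.ResolutionOfSingularities.Theorems.ShallowPort
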